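import Summits.QuantumFields.YangMills.Theorems.BalabanUVNodesK2OwnNumbersDefs

/-!
# Crux K2⁷ `EndpointGivenBR13SepCoPH` (stmt-QuantumFields-20543) — v7 DEFINER KIT: the drift-keyed pair over a per-tuple ADMISSIBILITY PREDICATE on reference sequences (concluder BY NAME),
# its CORNER instance = plan g84's v7 texts {2ᶜᴰ `CornerDriftPos`, 1ᶜᴿ `RunChain190AtCornerDriftSlope`} BY NAME with `Iff.rfl` mirrors of the skeleton's inline spelling (so the registered
# stubs can be FILED BY NAME), the reserve dials (c) `bOwnγ` (CRIT-2 R3, in-box base line) and (b) the fill pair of `…K2OwnNumbersDefs` §3b as instances, and the kernel witness that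
# the corner, the base-line face and the fill are three DIFFERENT objects (`ScaleAnchor` does not imply R3)

Cell `ym-nodeO-ideate`, DEFINER seat `ym-nodeO-def-1` (gen 6).  `--kind definition --supports stmt-QuantumFields-20543 --as helper --no-relocate`; count-neutral.
[I] = [Balaban1987RG1] Commun. Math. Phys. **109** (1987); [II] = [Balaban1988RG2Cluster] Commun. Math. Phys. **116** (1988).

WHY.  Plan g84's K2V7 WINDOW OUTCOME (pub-ymgap bus l.30600, 2026-08-28T07:04Z): the fill-keyed PRECUT bytes are NOT registered (CRIT-2 g3 (P2): at every record of record `v₀ := 0⃗`, so the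
fill `D.βfun k 0⃗ = beta0OfMerged βm θ.v₀ k` is the `limUnder` ALONG THE ZERO EDGE, outside [I] Thm 3's domain); the registered v7 is the CORNER RE-KEY (`[YMPLAN-G84-K2V7-REGISTERED 795c9e8285fed415]`, bus l.≈31090, 07:45:59Z; desk file
`pub-ymgap-plan/D84-K2V7/K2Skeleton13SepCoPHv7c.lean` sha16 `795c9e8285fed415`, :542 ∕ :558; `ledger skeleton check` OK on stmt-QuantumFields-20543): 2ᶜᴰ «prefix → ∃ b s A, ScaleAnchor D.βfun b ∧ 0 < s ∧ OneLoopDrift s A b», 1ᶜᴿ «prefix →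
∀ b s A, ScaleAnchor D.βfun b → 0 < s → OneLoopDrift s A b → ⟨p606097 §2's (190)-chain block at b, cap ≤ s⟩», stubs `stub_cornerDriftPos13` ∕ `stub_runChainCornerSlope13`; the plan to
DEF-1: «the REGISTERED texts are the CORNER pair — INTENT-8 by-name mirror re-cut to them» (draft 39189bf3 :535–:562 = registered :542–:567 VERBATIM).  THIS FILE does that, generically: §1 the drift-keyed pair over ANY
per-tuple predicate `P F θ hP : (ℕ → ℝ) → Prop` on reference sequences with its by-name concluder (every re-keying = one instantiation); §2 the CORNER instance
(`P := ScaleAnchor D.βfun`) under the skeleton's names, `Iff.rfl` to the inline texts, use forms; §3 reserve dial (c): CRIT-2's in-box base-line numbers `bOwnγ` BY NAME with their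
bookkeeping, and the KERNEL WITNESS `update_const_not_mem_histBox` that the corner letter does not read the base line (for `k ≥ 1`, `γ' < θ.γ` the base-line point is outside
`HistBox γ' k`) — so «corner = base-line face = fill» is [I] (2.13)-type history-independence CONTENT, not a corollary of `ScaleAnchor` (definer's confirm-window word, bus l.30702);
§4 reserve dial (b): the fill pair of `…K2OwnNumbersDefs` §3b IS §1's singleton instance, and `Iff.rfl` mirrors of its inline in-file spelling.

CONTENTS (7 `def` + 25 theorems; 0 `sorry`; [folklore] bookkeeping; no `instance`, no `notation`, no `axiom`).

HONEST FRAMING.  Definitions + `Iff.rfl` ∕ filter-germ ∕ binder bookkeeping; NOTHING of Bałaban asserted; no stub proved; nothing registered or re-registered here (the skeleton of record is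
the plan's v7 `795c9e8285fed415`, stubs `stub_cornerDriftPos13` ∕ `stub_runChainCornerSlope13`, 2 registered, 0 closed); no anchor, drift, limit or chain is proved to exist anywhere here; K2⁷ stmt-QuantumFields-20543 OPEN; (D1) ∕ (D4) NOT
discharged; counts unmoved (typed 28∕28 · discharged 5∕27).  [I] Thm 2 + (0.31) p. 259 (NODE O) UNPROVED IN PRINT.  Route R4 closes the CONDITIONAL finite-𝕋⁴ rung `BalabanLadder.UV`
only — NOT continuum, NOT ℝ⁴, NOT OS, NOT a mass gap, NOT Clay; the Yang–Mills mass gap is NOT proved by any of this.  Sources (context only): [I] Thm 2 p. 259, Thm 3 p. 264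
(«0 < g_k ≤ γ»), (1.22) p. 264, (2.12)–(2.14) p. 268, (5.10) p. 293; [II] Lemma 3 (2.38) p. 20.
-/

noncomputable section

open scoped Matrix.Norms.L2Operator Topology

namespace Summit.QuantumFields.YangMills.Theorems.BalabanUVNodesK2V7Defs

open Filter
open Literature.MathematicalPhysics.QuantumFieldTheory.Balaban1983to89
open Literature.MathematicalPhysics.QuantumFieldTheory.Balaban1983to89.FlowStep
open Literature.MathematicalPhysics.QuantumFieldTheory.Balaban1983to89.B12Beta (HistBox)
open Literature.MathematicalPhysics.QuantumFieldTheory.Balaban1983to89.B13ScaleTransfer (Pt)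
open Literature.MathematicalPhysics.QuantumFieldTheory.Balaban1983to89.DagBinding (EndpointExistence)
open Literature.MathematicalPhysics.QuantumFieldTheory.Balaban1983to89.T4Continuum (T4Family)
open Literature.MathematicalPhysics.QuantumFieldTheory.Balaban1983to89.Beta.Drift (OneLoopDrift)
open Literature.MathematicalPhysics.QuantumFieldTheory.Balaban1983to89.Beta.RemainderChainLattice
open Literature.MathematicalPhysics.QuantumFieldTheory.Balaban1983to89.Beta.RemainderLimitTorus (LDom limKernel)
open Literature.MathematicalPhysics.QuantumFieldTheory.Balaban1983to89.Beta.RemainderLocalityHolo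
open Literature.MathematicalPhysics.QuantumFieldTheory.Balaban1983to89.Beta.RemainderDecay190
open Literature.MathematicalPhysics.QuantumFieldTheory.Balaban1983to89.Beta.RemainderDecay190HoloChain
open Summit.QuantumFields.YangMills.Theorems.BalabanUVNodesK2NamedJetsRemAt (ScaleAnchor)
open Summit.QuantumFields.YangMills.Theorems.BalabanUVNodesK2NamedJetsRunRemAt (SurvCont)
open Summit.QuantumFields.YangMills.Theorems.BalabanUVNodesK2V6Defs (Window13)
open Summit.QuantumFields.YangMills.Theorems.BalabanUVNodesK2OwnNumbersDefs

/-! ## §1 The drift-keyed pair over a per-tuple admissibility predicate `P` on reference sequences, and its by-name concluder -/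

section Generic

variable (P : (F : T4Family) → (θ : Node00.Stage13HParams F 2) → θ.Provisos₁₃SepCoPH F 2 → (ℕ → ℝ) → Prop)

/-- **2ᴰ over `P`** (drift-keyed seam): at every tuple carrying the crux's prefix, SOME `P`-admissible reference sequence drifts with SOME POSITIVE slope.  HYPOTHESIS SHAPE ∕ obligation
text, never a fact.  Instances: corner `P := ScaleAnchor D.βfun` (§2, v7 of record), base line `P := (· = bOwnγ F θ hP)` (§3), fill `P := (· = bOwn F θ)` (§4). [folklore] -/
def DriftPosOver : Prop :=
  ∀ (F : T4Family) (θ : Node00.Stage13HParams F 2) (hP : θ.Provisos₁₃SepCoPH F 2), (θ.ZhUnity F 2 ∧ θ.SlotsNondegenerate₁₃ F 2) → θ.Admissible F 2 →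
    B16.EndStatementBPrinted (Node00.datumOfRecord₁₃SepCoPH F 2 θ hP).C → Window13 F θ hP →
    ∃ (b : ℕ → ℝ) (s A : ℝ), P F θ hP b ∧ 0 < s ∧ OneLoopDrift s A b

/-- **1ᴿ over `P`**: at every tuple carrying the crux's prefix, for every `P`-admissible `b` and every positive drift slope `s` of `b`, the run-wise (190)-chain of the record relative to
`b` with cap `≤ s` (`…K2OwnNumbersDefs.RunChain190At`).  HYPOTHESIS SHAPE ∕ obligation text, never a fact; size XL (NODE O; instance 0∕1). [folklore] -/
def RunChain190DriftSlopeOver : Prop :=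
  ∀ (F : T4Family) (θ : Node00.Stage13HParams F 2) (hP : θ.Provisos₁₃SepCoPH F 2), (θ.ZhUnity F 2 ∧ θ.SlotsNondegenerate₁₃ F 2) → θ.Admissible F 2 →
    B16.EndStatementBPrinted (Node00.datumOfRecord₁₃SepCoPH F 2 θ hP).C → Window13 F θ hP →
    ∀ (b : ℕ → ℝ) (s A : ℝ), P F θ hP b → 0 < s → OneLoopDrift s A b → RunChain190At F θ hP b s

/-- **★★ THE DRIFT-KEYED PAIR OVER ANY PREDICATE ⟹ THE CRUX DECL BY NAME** (`Summit.QuantumFields.YangMills.Theses.BalabanUVNodes.EndpointGivenBR13SepCoPH`): one `obtain`, then p606097's END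
via `…K2OwnNumbersDefs.endpointExistence_of_runChain190At_drift`.  CONDITIONAL on the two displayed texts; K2⁷ NOT closed; nothing of Bałaban asserted.
[cite: Balaban1987RG1, Thm 2 p.259 (first sentence), Thm 3 p.264, (2.12)–(2.14) p.268 and (5.10) p.293; Balaban1988RG2Cluster, Lemma 3 (2.38) p.20] -/
theorem EndpointGivenBR13SepCoPH_of_driftKeyedOver (h₁ : DriftPosOver P) (h₂ : RunChain190DriftSlopeOver P) :
    Summit.QuantumFields.YangMills.Theses.BalabanUVNodes.EndpointGivenBR13SepCoPH := by
  intro F θ hP hU hθ hB hwin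
  obtain ⟨b, s, A, hb, hs, hd⟩ := h₁ F θ hP hU hθ hB hwin
  exact endpointExistence_of_runChain190At_drift F θ hP (h₂ F θ hP hU hθ hB hwin b s A hb hs hd) hd

/-- USE FORM (any `P`): a `P`-admissible, positively drifting sequence at every Stage-13 tuple ⟹ 2ᴰ over `P` (prefix unused). [folklore] -/
theorem driftPosOver_of_all
    (h : ∀ (F : T4Family) (θ : Node00.Stage13HParams F 2) (hP : θ.Provisos₁₃SepCoPH F 2), ∃ (b : ℕ → ℝ) (s A : ℝ), P F θ hP b ∧ 0 < s ∧ OneLoopDrift s A b) :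
    DriftPosOver P :=
  fun F θ hP _ _ _ _ => h F θ hP

/-- USE FORM (any `P`): the per-tuple NODE-O shape keyed on admissibility alone ⟹ 1ᴿ over `P`. [folklore] -/
theorem runChain190DriftSlopeOver_of_adm
    (h : ∀ (F : T4Family) (θ : Node00.Stage13HParams F 2) (hP : θ.Provisos₁₃SepCoPH F 2), θ.Admissible F 2 →
      ∀ (b : ℕ → ℝ) (s A : ℝ), P F θ hP b → 0 < s → OneLoopDrift s A b → RunChain190At F θ hP b s) :
    RunChain190DriftSlopeOver P :=
  fun F θ hP _ hθ _ _ b s A hb hs hd => h F θ hP hθ b s A hb hs hd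

/-- MONOTONICITY IN THE PREDICATE: 2ᴰ is covariant (`P ≤ Q ⟹ 2ᴰ(P) → 2ᴰ(Q)`) … [folklore] -/
theorem driftPosOver_mono {P Q : (F : T4Family) → (θ : Node00.Stage13HParams F 2) → θ.Provisos₁₃SepCoPH F 2 → (ℕ → ℝ) → Prop}
    (hPQ : ∀ F θ hP b, P F θ hP b → Q F θ hP b) (h : DriftPosOver P) : DriftPosOver Q := fun F θ hP hU hθ hB hwin => by
  obtain ⟨b, s, A, hb, hs, hd⟩ := h F θ hP hU hθ hB hwin
  exact ⟨b, s, A, hPQ F θ hP b hb, hs, hd⟩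

/-- … and 1ᴿ is contravariant (`P ≤ Q ⟹ 1ᴿ(Q) → 1ᴿ(P)`): widening the admissible class weakens 2ᴰ and strengthens 1ᴿ. [folklore] -/
theorem runChain190DriftSlopeOver_anti {P Q : (F : T4Family) → (θ : Node00.Stage13HParams F 2) → θ.Provisos₁₃SepCoPH F 2 → (ℕ → ℝ) → Prop}
    (hPQ : ∀ F θ hP b, P F θ hP b → Q F θ hP b) (h : RunChain190DriftSlopeOver Q) : RunChain190DriftSlopeOver P :=
  fun F θ hP hU hθ hB hwin b s A hb hs hd => h F θ hP hU hθ hB hwin b s A (hPQ F θ hP b hb) hs hd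

end Generic

/-! ## §2 THE CORNER INSTANCE = plan g84's v7 texts BY NAME, `Iff.rfl` to the skeleton's inline spelling, use forms -/

section Corner

/-- **TEXT 2ᶜᴰ `CornerDriftPos` (v7 REGISTERED :542, stub `stub_cornerDriftPos13` :911; the skeleton's name ON PURPOSE)** «at every tuple carrying the crux's prefix the record's β HAS per-scale corner limits `b` from inside the box
(`ScaleAnchor`) and `b` drifts with SOME POSITIVE slope» = §1's 2ᴰ over `P := ScaleAnchor D.βfun`.  κ-free, v₀-free, `θ.cβ`-free.  HYPOTHESIS SHAPE ∕ obligation text, never a fact; owner line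
JOINT per the plan (corner existence U3∕N18 lane; identification to leading order NODE O ∕ def-T; (D1) sign + summability β cell); size L–XL. [cite: Balaban1987RG1, (1.3) p.260, (1.22) p.264 and (2.12)–(2.13) p.268] -/
def CornerDriftPos : Prop :=
  DriftPosOver (fun F θ hP => ScaleAnchor (Node00.datumOfRecord₁₃SepCoPH F 2 θ hP).βfun)

/-- **TEXT 1ᶜᴿ `RunChain190AtCornerDriftSlope` (v7 REGISTERED :558, stub `stub_runChainCornerSlope13` :918; the skeleton's name ON PURPOSE)** «rows (D4) ∧ B4 along the in-window runs + (C) on survivors, for the remainder relative to ANY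
anchored, positively drifting corner sequence `b`, cap `ε₁·K_rem,L ≤ s` against the given slope» = §1's 1ᴿ over `P := ScaleAnchor D.βfun`.  HYPOTHESIS SHAPE ∕ obligation text, never a
fact; size XL (NODE O; instance 0∕1). [cite: Balaban1987RG1, Thm 2 p.259 (first sentence), Thm 3 p.264, (2.12)–(2.14) p.268, (5.10) p.293; Balaban1988RG2Cluster, Lemma 3 (2.38) p.20] -/
def RunChain190AtCornerDriftSlope : Prop :=
  RunChain190DriftSlopeOver (fun F θ hP => ScaleAnchor (Node00.datumOfRecord₁₃SepCoPH F 2 θ hP).βfun)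

/-- **★★ THE CORNER PAIR ⟹ THE CRUX DECL BY NAME** — a registered v7 `{stub_cornerDriftPos13 : CornerDriftPos, stub_runChainCornerSlope13 : RunChain190AtCornerDriftSlope}` closes sorry-free by
`EndpointGivenBR13SepCoPH_of_cornerDriftKeyed stub_cornerDriftPos13 stub_runChainCornerSlope13` (= the skeleton's in-file composition :573 through p606097).  CONDITIONAL; K2⁷ NOT closed.
[cite: Balaban1987RG1, Thm 2 p.259 (first sentence), Thm 3 p.264, (2.12)–(2.14) p.268 and (5.10) p.293] -/
theorem EndpointGivenBR13SepCoPH_of_cornerDriftKeyed (h₁ : CornerDriftPos) (h₂ : RunChain190AtCornerDriftSlope) :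
    Summit.QuantumFields.YangMills.Theses.BalabanUVNodes.EndpointGivenBR13SepCoPH :=
  EndpointGivenBR13SepCoPH_of_driftKeyedOver _ h₁ h₂

/-- **2ᶜᴰ BY NAME ≡ THE SKELETON's INLINE 2ᶜᴰ TEXT** (registered `K2Skeleton13SepCoPHv7c.lean` 795c9e82 :542–:545 VERBATIM; `Window13` = `K2V6Defs.Window13`, same body as the skeleton's :309), `Iff.rfl`. [folklore] -/
theorem cornerDriftPos_iff_inline :
    CornerDriftPos ↔
      ∀ (F : T4Family) (θ : Node00.Stage13HParams F 2) (hP : θ.Provisos₁₃SepCoPH F 2), (θ.ZhUnity F 2 ∧ θ.SlotsNondegenerate₁₃ F 2) → θ.Admissible F 2 →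
        B16.EndStatementBPrinted (Node00.datumOfRecord₁₃SepCoPH F 2 θ hP).C → Window13 F θ hP →
        ∃ (b : ℕ → ℝ) (s A : ℝ), ScaleAnchor (Node00.datumOfRecord₁₃SepCoPH F 2 θ hP).βfun b ∧ 0 < s ∧ OneLoopDrift s A b :=
  Iff.rfl

/-- **1ᶜᴿ BY NAME ≡ THE SKELETON's INLINE 1ᶜᴿ TEXT** (registered `K2Skeleton13SepCoPHv7c.lean` 795c9e82 :558–:567 VERBATIM — p606097 §2's block at the anchored `b`, `(b, s, A)` + anchor + drift as
antecedents; `RunChain190At` unfolds), `Iff.rfl`. [folklore] -/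
theorem runChain190AtCornerDriftSlope_iff_inline :
    RunChain190AtCornerDriftSlope ↔
      ∀ (F : T4Family) (θ : Node00.Stage13HParams F 2) (hP : θ.Provisos₁₃SepCoPH F 2), (θ.ZhUnity F 2 ∧ θ.SlotsNondegenerate₁₃ F 2) → θ.Admissible F 2 →
        B16.EndStatementBPrinted (Node00.datumOfRecord₁₃SepCoPH F 2 θ hP).C → Window13 F θ hP →
        ∀ (b : ℕ → ℝ) (s A : ℝ), ScaleAnchor (Node00.datumOfRecord₁₃SepCoPH F 2 θ hP).βfun b → 0 < s → OneLoopDrift s A b →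
        ∃ (M : ℕ) (_ : NeZero M) (μ ν : Fin 4) (c : B13.Consts) (ℓ α₂ : ℝ) (q : Consts190) (γ₀ : ℝ),
          (∀ (n : ℕ) (gs : ℕ → ℝ), RGEqH n (Node00.datumOfRecord₁₃SepCoPH F 2 θ hP).βfun gs → Step.InInterval γ₀ n gs → ∀ k, k ≤ n →
            ∃ a : LDom 4 → Pt 4 → ℝ, (Node00.datumOfRecord₁₃SepCoPH F 2 θ hP).βfun k (prefixOf gs k) - b k =
              B12Beta.secondMoment (fun _ _ => limKernel a) μ ν ∧ Nonempty (PolLeavesTFac190H 4 M a c ℓ α₂ q)) ∧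
          CondsL 4 c ℓ ∧ c.R22gen ℓ ∧ q.Valid c.δ₀ ∧ SignsL c α₂ q.B₃ ∧ 0 < γ₀ ∧
          c.ε₁ * remCoeffL 4 M c α₂ q.B₃ ≤ s ∧ SurvCont (Node00.datumOfRecord₁₃SepCoPH F 2 θ hP).βfun γ₀ :=
  Iff.rfl

/-- USE FORM for a supplier of `stub_cornerDriftPos13` (name ∕ shape = the skeleton's `cornerDriftPos_of_anchorDrift_all` :583): an anchored, positively drifting corner sequence at every Stage-13
tuple ⟹ 2ᶜᴰ BY NAME (prefix unused; the conclusion SHAPE of the U3 ∕ N17 corner roads). [folklore] -/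
theorem cornerDriftPos_of_anchorDrift_all
    (h : ∀ (F : T4Family) (θ : Node00.Stage13HParams F 2) (hP : θ.Provisos₁₃SepCoPH F 2),
      ∃ (b : ℕ → ℝ) (s A : ℝ), ScaleAnchor (Node00.datumOfRecord₁₃SepCoPH F 2 θ hP).βfun b ∧ 0 < s ∧ OneLoopDrift s A b) :
    CornerDriftPos :=
  driftPosOver_of_all _ h

/-- USE FORM for the NODE-O owner of `stub_runChainCornerSlope13`: per tuple, keyed on admissibility alone, the chain relative to every anchored corner sequence with cap against each of
its positive drift slopes ⟹ 1ᶜᴿ BY NAME. [folklore] -/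
theorem runChain190AtCornerDriftSlope_of_adm
    (h : ∀ (F : T4Family) (θ : Node00.Stage13HParams F 2) (hP : θ.Provisos₁₃SepCoPH F 2), θ.Admissible F 2 →
      ∀ (b : ℕ → ℝ) (s A : ℝ), ScaleAnchor (Node00.datumOfRecord₁₃SepCoPH F 2 θ hP).βfun b → 0 < s → OneLoopDrift s A b → RunChain190At F θ hP b s) :
    RunChain190AtCornerDriftSlope :=
  runChain190DriftSlopeOver_of_adm _ h

/-- The anchor DETERMINES the corner sequence handed to NODE O (`ScaleAnchor.eq`, p593586): 1ᶜᴿ's `∀ b` ranges over at most one sequence per tuple (= the skeleton's `corner_unique` :591). [folklore] -/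
theorem corner_unique {F : T4Family} {θ : Node00.Stage13HParams F 2} {hP : θ.Provisos₁₃SepCoPH F 2} {b b' : ℕ → ℝ}
    (h : ScaleAnchor (Node00.datumOfRecord₁₃SepCoPH F 2 θ hP).βfun b) (h' : ScaleAnchor (Node00.datumOfRecord₁₃SepCoPH F 2 θ hP).βfun b') : b = b' :=
  h.eq h'

end Corner

/-! ## §3 Reserve dial (c): the IN-BOX BASE-LINE numbers `bOwnγ` (CRIT-2 R3) BY NAME; the corner, the base-line face and the fill are three different objects -/

section BaseLine

variable (F : T4Family) (θ : Node00.Stage13HParams F 2) (hP : θ.Provisos₁₃SepCoPH F 2)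

/-- **`bOwnγ F θ hP` — THE RECORD's β ALONG THE CONSTANT-γ BASE LINE, LAST COUPLING `g → 0⁺`** (CRIT-2 g3 R3's text verbatim; an4 g153 concur): `limUnder (𝓝[>] 0) (g ↦ D.βfun k (θ.γ, …, θ.γ, g))`.
For `0 < g ≤ θ.γ` the base-line history lies IN `Box θ.γ k`, where the datum's β IS the merged β — `v₀`-FREE, inside [I] Thm 3's domain; junk unless the one-sided limit exists; under `0 < θ.γ`
it IS `Node00.beta0OfMerged βm (fun _ _ => θ.γ)`, the record's one-loop number object AT THE CONSTANT-γ BASE (`bOwnγ_eq_beta0OfMerged`).  NOT the corner limit of `ScaleAnchor` for `k ≥ 1`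
(`update_const_not_mem_histBox`).  A definition asserting nothing. [cite: Balaban1987RG1, (2.12)–(2.14) p.268 and Thm 3 p.264] -/
def bOwnγ : ℕ → ℝ :=
  fun k => limUnder (𝓝[>] (0 : ℝ)) (fun g : ℝ => (Node00.datumOfRecord₁₃SepCoPH F 2 θ hP).βfun k (Function.update (fun _ => θ.γ) (Fin.last k) g))

variable {F θ hP}

/-- The base-line history with last entry `g` lies IN the box of record iff `0 < g ≤ θ.γ` (given `0 < θ.γ`). [folklore] -/
theorem update_const_mem_box_iff (hγ : 0 < θ.γ) {k : ℕ} {g : ℝ} :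
    Function.update (fun _ : Fin (k + 1) => θ.γ) (Fin.last k) g ∈ Box θ.γ k ↔ 0 < g ∧ g ≤ θ.γ := by
  rw [mem_box]
  constructor
  · intro h
    simpa using h (Fin.last k)
  · rintro ⟨hg0, hgle⟩ i
    by_cases hi : i = Fin.last k
    · subst hi; simpa using And.intro hg0 hgle
    · simp [Function.update_of_ne hi, hγ]

/-- **★ KERNEL WITNESS «THE CORNER LETTER DOES NOT READ THE BASE LINE»**: for `k ≥ 1` and `γ' < θ.γ` the base-line history `(θ.γ, …, θ.γ, g)` is NOT in `HistBox γ' k` (its first coupling is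
`θ.γ > γ'`), whatever `g` — while `ScaleAnchor β b` (p593586 :104) only constrains `β k` on `HistBox γ' k` for SMALL `γ'`.  So `ScaleAnchor D.βfun b` implies nothing about `bOwnγ` (nor about
the off-box fill `bOwn`): «corner limit = base-line face = fill» is [I] (2.13)-type history-independence of the `g_k → 0⁺` face — CONTENT (NODE O ∕ def-T), booked in 2ᶜᴰ's joint owner line, not
a corollary. [folklore] -/
theorem update_const_not_mem_histBox {k : ℕ} (hk : 1 ≤ k) {γ' : ℝ} (hγ' : γ' < θ.γ) (g : ℝ) :
    Function.update (fun _ : Fin (k + 1) => θ.γ) (Fin.last k) g ∉ HistBox γ' k := by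
  intro hmem
  have h0 := hmem ⟨0, Nat.succ_pos k⟩
  have hne : (⟨0, Nat.succ_pos k⟩ : Fin (k + 1)) ≠ Fin.last k := by
    intro h
    have := congrArg Fin.val h
    simp [Fin.last] at this
    omega
  rw [Function.update_of_ne hne] at h0
  exact not_lt.mpr h0.2 hγ'

/-- ON THE BASE LINE, INSIDE THE BOX, THE DATUM's β IS THE MERGED β (box convention `Node00.betaOfMerged_of_mem`). [cite: Balaban1987RG1, (1.22) p.264 (bookkeeping)] -/
theorem βfun_update_const_eq_merged (hγ : 0 < θ.γ) {k : ℕ} {g : ℝ} (hg0 : 0 < g) (hgle : g ≤ θ.γ) :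
    letI := θ.instVβ₁; letI := θ.instVβ₂; letI := θ.instιβ
    (Node00.datumOfRecord₁₃SepCoPH F 2 θ hP).βfun k (Function.update (fun _ => θ.γ) (Fin.last k) g) =
      Node00.betaMerged F (Node00.mergedTermFamilyMatT F 2 (Node00.TcanOfRecord F 2) (Node00.chiFixed29 F 2 θ.ν θ.ε₂₉) θ.εbg) θ.ρ8 θ.bV k
        (Function.update (fun _ => θ.γ) (Fin.last k) g) :=
  Node00.betaOfMerged_of_mem _ _ _ ((update_const_mem_box_iff hγ).mpr ⟨hg0, hgle⟩)

/-- **`bOwnγ` IS THE RECORD's ONE-LOOP NUMBER OBJECT AT THE CONSTANT-γ BASE**: for `0 < θ.γ`, `bOwnγ F θ hP = Node00.beta0OfMerged βm (fun _ _ => θ.γ)` — the two `limUnder`s are over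
functions agreeing on `]0, θ.γ]`, a neighbourhood of `0` within `]0, ∞[` (`Filter.map_congr`).  So `Node00.Beta0LimitExists βm (fun _ _ => θ.γ)` and N17's (AF-0r) at THAT base speak about
`bOwnγ`. [cite: Balaban1987RG1, (2.12)–(2.14) p.268 (bookkeeping)] -/
theorem bOwnγ_eq_beta0OfMerged (hγ : 0 < θ.γ) :
    letI := θ.instVβ₁; letI := θ.instVβ₂; letI := θ.instιβ
    bOwnγ F θ hP = Node00.beta0OfMerged
      (Node00.betaMerged F (Node00.mergedTermFamilyMatT F 2 (Node00.TcanOfRecord F 2) (Node00.chiFixed29 F 2 θ.ν θ.ε₂₉) θ.εbg) θ.ρ8 θ.bV) (fun _ _ => θ.γ) := by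
  letI := θ.instVβ₁; letI := θ.instVβ₂; letI := θ.instιβ
  funext k
  show limUnder _ _ = limUnder _ _
  unfold limUnder
  congr 1
  refine Filter.map_congr ?_
  filter_upwards [Ioc_mem_nhdsGT hγ] with g hg
  exact βfun_update_const_eq_merged hγ hg.1 hg.2

/-- AT R1-RE-PINNED RECORDS THE FILL AND THE BASE-LINE FACE ARE ONE OBJECT: if `θ.v₀ = fun _ _ => θ.γ` (node00-def's re-pin R1) and `0 < θ.γ`, then `bOwn F θ = bOwnγ F θ hP`
(`bOwn_eq_beta0OfMerged` ∘ `bOwnγ_eq_beta0OfMerged`).  (Neither is thereby the CORNER sequence — see `update_const_not_mem_histBox`.) [folklore] -/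
theorem bOwn_eq_bOwnγ_of_basePin (hγ : 0 < θ.γ) (hv : θ.v₀ = fun _ _ => θ.γ) : bOwn F θ = bOwnγ F θ hP := by
  rw [bOwnγ_eq_beta0OfMerged hγ, bOwn_eq_beta0OfMerged F θ, hv]

/-- Under the NAMED existence clause at the constant-γ base, `bOwnγ k` IS the `g → 0⁺` limit of the merged β along the base line (`Node00.tendsto_beta0OfMerged`). [cite: Balaban1987RG1, (2.12)–(2.14) p.268] -/
theorem tendsto_bOwnγ (hγ : 0 < θ.γ)
    (h : letI := θ.instVβ₁; letI := θ.instVβ₂; letI := θ.instιβ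
      Node00.Beta0LimitExists
        (Node00.betaMerged F (Node00.mergedTermFamilyMatT F 2 (Node00.TcanOfRecord F 2) (Node00.chiFixed29 F 2 θ.ν θ.ε₂₉) θ.εbg) θ.ρ8 θ.bV) (fun _ _ => θ.γ))
    (k : ℕ) :
    letI := θ.instVβ₁; letI := θ.instVβ₂; letI := θ.instιβ
    Tendsto (fun g : ℝ =>
        Node00.betaMerged F (Node00.mergedTermFamilyMatT F 2 (Node00.TcanOfRecord F 2) (Node00.chiFixed29 F 2 θ.ν θ.ε₂₉) θ.εbg) θ.ρ8 θ.bV k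
          (Function.update (fun _ => θ.γ) (Fin.last k) g))
      (𝓝[>] (0 : ℝ)) (𝓝 (bOwnγ F θ hP k)) := by
  letI := θ.instVβ₁; letI := θ.instVβ₂; letI := θ.instιβ
  rw [bOwnγ_eq_beta0OfMerged hγ]
  exact Node00.tendsto_beta0OfMerged _ _ h k

/-- **TEXT 2ᴰγ (reserve dial (c), base-line keying)**: §1's 2ᴰ over the singleton predicate `(· = bOwnγ F θ hP)`.  Obligation text, never a fact; NOT registered. [folklore] -/
def OwnNumbersDriftPosγ : Prop := DriftPosOver (fun F θ hP b => b = bOwnγ F θ hP)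

/-- **TEXT 1ᴿγ (reserve dial (c))**: §1's 1ᴿ over `(· = bOwnγ F θ hP)`.  Obligation text, never a fact; NOT registered. [folklore] -/
def RunChain190AtOwnDriftSlopeγ : Prop := RunChain190DriftSlopeOver (fun F θ hP b => b = bOwnγ F θ hP)

/-- The base-line pair ⟹ the crux decl BY NAME (reserve dial (c); CONDITIONAL). [folklore] -/
theorem EndpointGivenBR13SepCoPH_of_ownNumbersDriftKeyedγ (h₁ : OwnNumbersDriftPosγ) (h₂ : RunChain190AtOwnDriftSlopeγ) :
    Summit.QuantumFields.YangMills.Theses.BalabanUVNodes.EndpointGivenBR13SepCoPH :=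
  EndpointGivenBR13SepCoPH_of_driftKeyedOver _ h₁ h₂

/-- 2ᴰγ in CRIT-2's R3 spelling («prefix → ∃ s A, 0 < s ∧ OneLoopDrift s A bOwnγ»; the singleton `∃ b, b = bOwnγ ∧ …` collapsed). [folklore] -/
theorem ownNumbersDriftPosγ_iff :
    OwnNumbersDriftPosγ ↔
      ∀ (F : T4Family) (θ : Node00.Stage13HParams F 2) (hP : θ.Provisos₁₃SepCoPH F 2), (θ.ZhUnity F 2 ∧ θ.SlotsNondegenerate₁₃ F 2) → θ.Admissible F 2 →
        B16.EndStatementBPrinted (Node00.datumOfRecord₁₃SepCoPH F 2 θ hP).C → Window13 F θ hP →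
        ∃ s A : ℝ, 0 < s ∧ OneLoopDrift s A (bOwnγ F θ hP) := by
  constructor
  · intro h F θ hP hU hθ hB hwin
    obtain ⟨b, s, A, rfl, hs, hd⟩ := h F θ hP hU hθ hB hwin
    exact ⟨s, A, hs, hd⟩
  · intro h F θ hP hU hθ hB hwin
    obtain ⟨s, A, hs, hd⟩ := h F θ hP hU hθ hB hwin
    exact ⟨bOwnγ F θ hP, s, A, rfl, hs, hd⟩

/-- 1ᴿγ in CRIT-2's R3 spelling («prefix → ∀ s A, 0 < s → OneLoopDrift s A bOwnγ → RunChain190At … bOwnγ s»). [folklore] -/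
theorem runChain190AtOwnDriftSlopeγ_iff :
    RunChain190AtOwnDriftSlopeγ ↔
      ∀ (F : T4Family) (θ : Node00.Stage13HParams F 2) (hP : θ.Provisos₁₃SepCoPH F 2), (θ.ZhUnity F 2 ∧ θ.SlotsNondegenerate₁₃ F 2) → θ.Admissible F 2 →
        B16.EndStatementBPrinted (Node00.datumOfRecord₁₃SepCoPH F 2 θ hP).C → Window13 F θ hP →
        ∀ (s A : ℝ), 0 < s → OneLoopDrift s A (bOwnγ F θ hP) → RunChain190At F θ hP (bOwnγ F θ hP) s := by
  constructor
  · intro h F θ hP hU hθ hB hwin s A hs hd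
    exact h F θ hP hU hθ hB hwin _ s A rfl hs hd
  · intro h F θ hP hU hθ hB hwin b s A hb hs hd
    subst hb
    exact h F θ hP hU hθ hB hwin s A hs hd

end BaseLine

/-! ## §4 Reserve dial (b): the FILL pair of `…K2OwnNumbersDefs` §3b is §1's singleton instance; `Iff.rfl` mirrors of its inline in-file spelling (kept UNREGISTERED in the v7 file, «reserve dial (b)») -/

section Fill

/-- §3b's 2ᴼᴰ `OwnNumbersDriftPos` ⟺ §1's 2ᴰ over the singleton predicate `(· = bOwn F θ)`. [folklore] -/
theorem ownNumbersDriftPos_iff_over : OwnNumbersDriftPos ↔ DriftPosOver (fun F θ _ b => b = bOwn F θ) := by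
  constructor
  · intro h F θ hP hU hθ hB hwin
    obtain ⟨s, A, hs, hd⟩ := h F θ hP hU hθ hB hwin
    exact ⟨bOwn F θ, s, A, rfl, hs, hd⟩
  · intro h F θ hP hU hθ hB hwin
    obtain ⟨b, s, A, rfl, hs, hd⟩ := h F θ hP hU hθ hB hwin
    exact ⟨s, A, hs, hd⟩

/-- §3b's 1ᴼᴿ `RunChain190AtOwnDriftSlope` ⟺ §1's 1ᴿ over `(· = bOwn F θ)`. [folklore] -/
theorem runChain190AtOwnDriftSlope_iff_over : RunChain190AtOwnDriftSlope ↔ RunChain190DriftSlopeOver (fun F θ _ b => b = bOwn F θ) := by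
  constructor
  · intro h F θ hP hU hθ hB hwin b s A hb hs hd
    subst hb
    exact h F θ hP hU hθ hB hwin s A hs hd
  · intro h F θ hP hU hθ hB hwin s A hs hd
    exact h F θ hP hU hθ hB hwin _ s A rfl hs hd

/-- **§3b's 2ᴼᴰ BY NAME ≡ THE SKELETON's (UNREGISTERED) INLINE FILL TEXT** (`bOwn` spelled `fun k => (datum).βfun k (fun _ => 0)`), `Iff.rfl` — the datum's `βfun` IS
`betaOfRecord₁₃ F 2 θ.toStage13Params` (`Node00.βfun_datumOfRecord₁₃SepCoPH` = `rfl`). [folklore] -/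
theorem ownNumbersDriftPos_iff_inline :
    OwnNumbersDriftPos ↔
      ∀ (F : T4Family) (θ : Node00.Stage13HParams F 2) (hP : θ.Provisos₁₃SepCoPH F 2), (θ.ZhUnity F 2 ∧ θ.SlotsNondegenerate₁₃ F 2) → θ.Admissible F 2 →
        B16.EndStatementBPrinted (Node00.datumOfRecord₁₃SepCoPH F 2 θ hP).C → Window13 F θ hP →
        ∃ s A : ℝ, 0 < s ∧ OneLoopDrift s A (fun k => (Node00.datumOfRecord₁₃SepCoPH F 2 θ hP).βfun k (fun _ => 0)) :=
  Iff.rfl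

/-- **§3b's 1ᴼᴿ BY NAME ≡ THE SKELETON's (UNREGISTERED) INLINE FILL TEXT**, `Iff.rfl`. [folklore] -/
theorem runChain190AtOwnDriftSlope_iff_inline :
    RunChain190AtOwnDriftSlope ↔
      ∀ (F : T4Family) (θ : Node00.Stage13HParams F 2) (hP : θ.Provisos₁₃SepCoPH F 2), (θ.ZhUnity F 2 ∧ θ.SlotsNondegenerate₁₃ F 2) → θ.Admissible F 2 →
        B16.EndStatementBPrinted (Node00.datumOfRecord₁₃SepCoPH F 2 θ hP).C → Window13 F θ hP →
        ∀ (s A : ℝ), 0 < s → OneLoopDrift s A (fun k => (Node00.datumOfRecord₁₃SepCoPH F 2 θ hP).βfun k (fun _ => 0)) →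
        ∃ (M : ℕ) (_ : NeZero M) (μ ν : Fin 4) (c : B13.Consts) (ℓ α₂ : ℝ) (q : Consts190) (γ₀ : ℝ),
          (∀ (n : ℕ) (gs : ℕ → ℝ), RGEqH n (Node00.datumOfRecord₁₃SepCoPH F 2 θ hP).βfun gs → Step.InInterval γ₀ n gs → ∀ k, k ≤ n →
            ∃ a : LDom 4 → Pt 4 → ℝ, (Node00.datumOfRecord₁₃SepCoPH F 2 θ hP).βfun k (prefixOf gs k) - (Node00.datumOfRecord₁₃SepCoPH F 2 θ hP).βfun k (fun _ => 0) =
              B12Beta.secondMoment (fun _ _ => limKernel a) μ ν ∧ Nonempty (PolLeavesTFac190H 4 M a c ℓ α₂ q)) ∧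
          CondsL 4 c ℓ ∧ c.R22gen ℓ ∧ q.Valid c.δ₀ ∧ SignsL c α₂ q.B₃ ∧ 0 < γ₀ ∧
          c.ε₁ * remCoeffL 4 M c α₂ q.B₃ ≤ s ∧ SurvCont (Node00.datumOfRecord₁₃SepCoPH F 2 θ hP).βfun γ₀ :=
  Iff.rfl

/-- USE FORM for the fill 2ᴼᴰ (name ∕ shape = the v7 draft's `ownNumbersDriftPos_of_drift_all`). [folklore] -/
theorem ownNumbersDriftPos_of_drift_all
    (h : ∀ (F : T4Family) (θ : Node00.Stage13HParams F 2) (hP : θ.Provisos₁₃SepCoPH F 2),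
      ∃ s A : ℝ, 0 < s ∧ OneLoopDrift s A (fun k => (Node00.datumOfRecord₁₃SepCoPH F 2 θ hP).βfun k (fun _ => 0))) :
    OwnNumbersDriftPos :=
  fun F θ hP _ _ _ _ => h F θ hP

end Fill

end Summit.QuantumFields.YangMills.Theorems.BalabanUVNodesK2V7Defs

end
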